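import Literature.MathematicalPhysics.QuantumFieldTheory.Balaban1983to89.B1Eq324BenfattoClassSectEMemberPrecisionDoorRecordV4PAdjCurrentCancel

/-!
# `Balaban1983to89.B1Eq324BenfattoClassSectEMemberPrecisionDoorRecordV4PAdjCurrentCancelLeaf` — THE ★★★★★ STAR DOOR MODULO NODE N06's CERTIFICATE: the 𝒥-row's
# `C₁ = (QG₁Q*)⁻¹` letter DERIVED INSIDE from the certificate's own row-26 (3.132) conjunct, `G₁`'s (3.42)₁ letter taken in node N06's family shape, the `PinPrims`
# record and every road constant INTERNAL (seat dag-n08-d g44, INTENT-113; node N08 [Balaban1985UV3], row `h324c`)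

statement-level companion of published sources with citation tags; every declaration here is a theorem; nothing here is a claim about the
Yang–Mills mass gap

T. Bałaban, *Propagators for lattice gauge theories in a background field*, Commun. Math. Phys. **99** (1985) 389–434 [Balaban1985BackgroundPropagators] (= [B9]):
(3.42) p. 397, p. 398 (remark after (3.47)), (3.123) p. 420, (3.128)–(3.129) p. 421, (3.132)–(3.136) p. 422 and the sentence between (3.136) and (3.137), Thm 3.11 p. 416,
Thm 3.12 p. 423, (3.35)–(3.36) p. 396, (3.155)–(3.158) pp. 427–428, Thms 3.1–3.15 pp. 397–432 (the leaf); [Balaban1984PropagatorsII] (= [4]) (2.1) p. 224, (2.51)–(2.56)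
pp. 232–233, Lemma 2.1 (2.60)–(2.61) pp. 233–234, (2.149) p. 249, (2.3) p. 224, Lemma 2.4 p. 245; [Balaban1985Averaging] (= [5]) (125)–(126) p. 36, (136) p. 39; [Balaban1985UV3]
(24) p. 262; [Balaban1982Higgs1] (3.24) p. 616; [BenfattoEtAl1978] Lemma (4.5)–(4.7) p. 152.

WHY THIS MODULE (cell `pub-ymgap`, seat `dag-n08-d` gen 44, INTENT-113, 2026-08-29).  `…AdjCurrentCancel` (INTENT-112) displays, besides node N06's certificate `h06`,
the two Sect.-D letters `hG1e0` ∕ `hC1raw`, a `PinPrims` record `q` and the road constants `r_G, r_C, ρ_R, t_{HJ}, M_T, a_T` with their budget rows.  But the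
certificate ALREADY carries row 26 — `h06.s3132 : B9.Stmt3132Printed (d+1) c35Y geo9Y (bg9YP …) (siteKernelP (…).QGQinv) (siteKernelP (…).QG1Qinv)`, whose second
kernel IS the `ν`-reading of `(QG₁Q*)⁻¹[G′_phys, Δ⁽²⁾]` (def-Y `opsYNuStOfRecordV4PE_QGQinv_QG1Qinv`, `rfl`) — and dag-n06-i's bridge `hasMaj_cNorm_weightNorm_coordOpK_geo9Y_of_ineq3132Nu`
+ n06-w5's `const3132_le` ∕ `hasMajorantHom_raw_of_hasMaj_cNorm_weightNorm` + `B9Eq3129H1TransposeCancel.blockCount_eq_pow_lvl` turn it into `hC1raw` at any rate below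
`δ₁/2` above the transfer threshold `2 log L ≤ (δ₁/2)(2L²−1)M`.  THIS FILE does that INSIDE the door and chooses the `PinPrims` record (`α = α_F = 1∕4`,
`δ₀ := min(δ₁∕2, δ_G)`), `ρ_R := (5∕8)δ₀`, `a_T := min(a₀, a₂, (10L⁷)⁻¹)`, `M_T := max(M₄, M₂, M_C)`, `t_{HJ} :=` the explicit product; `G₁`'s (3.42)₁ letter enters in node
N06's own family shape (`B9Eq3132DecayFromMajorant[R]`'s `∃ M₂ a₂ C δ, … HasMajorant (blkBK (bI x)) (GcoK … (T₁ x) U) (C·(Lʲη)_a²·e^{−δd})` at `T₁ x := G1Y … (GpPhysY …) (𝔯 x).Δ2`,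
regime `bg9YP` at `c35Y`).
* §1 ★★★★★ `eq324_CsDeltaCPstY_lettersYOfRecordV4P_sectEStYOfRecordV7_trBasis_of_b9LeafX_of_G1fam_of_pivotLines_onΛst_on_unit` — node-N06-side binders EXACTLY `h06` + `hG1fam` + `hΔ2`;
  ★★★★★ `…_of_b9LeafX_of_G1fam_of_pivotLines_ofC2_onΛst_on_unit` — the twin over `𝔯 := resYOfC2 𝔠` with [5]'s `hCr`.
WHAT STANDS BETWEEN THIS DOOR AND N08's ROW `h324c`: node N06's certificate and its (3.42)₁ letter for `G₁` (N06's pen); of def-Y ∕ [5]: the symmetry schema `hΔ2` of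
`Δ⁽²⁾`, reality of `(𝔢₀ x).D2J U`, the PIN, (c) locality ∕ size of `D̃⁽²⁾`; NODE 00's pivot-line row; G-B9-09's `γ₀`; the IDENT.
HONEST SCOPE.  Count-neutral compositions BY NAME over landed modules (112 §1, 111 §1b, dag-n06-i, n06-w5, def-Y); inside the proof a `PinPrims` record is BUILT (anonymous
constructor, `OK` by `norm_num`) — no `def`; no estimate of [B9] ∕ [4] ∕ [5] is asserted: row 26 and Thm 3.12 are the CERTIFICATE's ∕ `hG1fam`'s content, displayed; IDENT `h324c`
NOT made; node N06 ∕ N08 NOT discharged; one finite 𝕋^{d+1} programme — nothing about d = 4 specifically, the continuum, OS axioms, a mass gap or the Clay problem.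
No `sorry`, no `def`, no `instance`, no `notation`.
-/

noncomputable section

open MeasureTheory Finset Matrix
open scoped Matrix.Norms.L2Operator

namespace Literature.MathematicalPhysics.QuantumFieldTheory.Balaban1983to89.B1Eq324BenfattoClassSectEMemberPrecisionDoorRecordV4PAdjCurrentCancelLeaf

open Literature.MathematicalPhysics.QuantumFieldTheory
open Literature.MathematicalPhysics.QuantumFieldTheory.Balaban1983to89.B1Eq324BenfattoLemma
open Literature.MathematicalPhysics.QuantumFieldTheory.Balaban1983to89.Node00
open Literature.MathematicalPhysics.QuantumFieldTheory.Balaban1983to89.DagBinding (B9LeafX)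
open B6KLevelCensusIndexV1 (KIdx)
open B6BondElimination (unitVec)
open B9PinMembersKLevelV1 (MemberY geo9Y bg9Y)
open B9BackgroundsKLevelV1P (bg9YP)
open B9PinCarriersKLevelV1P (siteKernelP)
open B9PinGeometryKLevelV1 (unitDistY)
open B9GeoNormsKLevelV1 (geo9K geo9K_dist_nonneg)
open B9GeoLemma21KLevelV1 (geo9Y_len_pos geo9Y_dist_triangle geo9Y_dist_comm)
open B9Thm311ReadingCoords (trIP IsSymmTr)
open B9CoReadingCoordsTranspose (trReForm TrIdx trBasis)
open B9CoReadingCoords (XBK blkBK GcoK)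
open B9CoReadingCoordsH (XHK blkHK HcoK)
open Node00.OpsYSectDCoords (QcoKH C1coK)
open B9Thm39ReadingCoords (basisBound39 coordBound39 cR39 abs_repr_le)
open B9Thm37Glue (IsTransposePair)
open B9Thm34Ext (toB6)
open B9Thm312Whole (GeoOK cNorm)
open B9SectDSup (weightNorm)
open B11SectG (HasMaj BlockNorm)
open B6RandomWalk (HasMajorant)
open B6RandomWalkHom (HasMajorantHom)
open B9RWSumsDefinitePins (PinPrims)
open B9RWSums347DefiniteFaces (exp261)
open B9RowSum261DefiniteFaces (rowConst261)
open B6Geom246MultiLevelTorus (geomT)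
open B6GlobalChartV1 (blkV1)
open B6Ineq2142KLevelV1 (β lvl)
open B7Prop2Explicit (unitaryUnits)
open B7Prop2SpecialUnitary (specialUnitaryUnits specialUnitaryUnits_le_unitaryUnits)
open B9Eq3132NuReading (siteKernelOfOpNu nuY)
open B9Eq3132ClassLetterFromNu (hasMaj_cNorm_weightNorm_coordOpK_geo9Y_of_ineq3132Nu)
open B9LettersZCFieldsAtPins (const3132_le hasMajorantHom_raw_of_hasMaj_cNorm_weightNorm)
open B9Eq3129H1TransposeCancel (blockCount_eq_pow_lvl)
open B9Eq3136HstarJAtPinsLetterFamily (etaBY_pos')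
open B1Eq324BenfattoClassSectEMemberPrecisionDoorRecordV4PAdjCurrentCancel
  (eq324_CsDeltaCPstY_lettersYOfRecordV4P_sectEStYOfRecordV7_trBasis_of_b9LeafX_of_G1e0C1rawLetters_of_pivotLines_onΛst_on_unit
   eq324_CsDeltaCPstY_lettersYOfRecordV4P_sectEStYOfRecordV7_trBasis_of_b9LeafX_of_G1e0C1rawLetters_of_pivotLines_ofC2_onΛst_on_unit)

/-! ## §1  The ★★★★★ star door: `C₁` derived inside from `h06.s3132`, `G₁` in node N06's family shape, constants internal -/

section Door

/-- ★★★★★ **THE STAR DOOR OF RECORD MODULO NODE N06's CERTIFICATE, 𝒥-ROW FED BY THE CANCELLING ROAD WITH `C₁` DERIVED INSIDE** — what it displays of node N06: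
`h06 : B9LeafX (Y9OfRecordP … (opsYNuStOfRecordV4PE …))` (its row 26 `h06.s3132` supplies the (3.132) kernel of `(QG₁Q*)⁻¹[G′_phys, Δ⁽²⁾]`, from which the raw letter
`hC1raw` of `…AdjCurrentCancel` is derived inside at rate `min(δ₁∕2, δ_G)` above the transfer threshold), `hG1fam` ((3.42)₁ for `G₁` in the family shape of
`B9Eq3132DecayFromMajorant` — `∃ M₂ a₂ C_G δ_G, … HasMajorant (blkBK (bI x)) (GcoK … (G1Y … (GpPhysY …) (𝔯 x).Δ2) U) (C_G·(Lʲη)_a²·e^{−δ_G d})`), and [5]'s symmetry schema `hΔ2` of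
the residual; of NODE 00: the pins `bI ∕ hbI0 ∕ hβ1`, `Hg`; per background: print's class, the pivot-line smallness, reality of `(𝔢₀ x).D2J U`, the PIN, (c) locality ∕ size of
`D̃⁽²⁾`, the Δ_k-row `γ₀`.  NO `C₁` letter, NO `PinPrims`, NO weight law, NO road constant is displayed: the proof BUILDS `q` (`α = α_F = 1∕4`, `δ₀ = min(δ₁∕2, δ_G)`), the budget
`ρ_R = (5∕8)δ₀`, `a_T`, `M_T`, `t_{HJ}` and calls `…AdjCurrentCancel` §1.
[cite: Balaban1985BackgroundPropagators, p.422 (the sentence between (3.136) and (3.137)), (3.42) p.397, p.398 (remark after (3.47)), (3.123) p.420, (3.128)–(3.129) p.421,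
(3.132)–(3.133) p.422, Thm 3.12 p.423, (3.35)–(3.36) p.396, (3.155)–(3.158) pp.427–428, Thms 3.1–3.15 pp.397–432 (the leaf); Balaban1984PropagatorsII, (2.1) p.224, (2.51)–(2.56)
pp.232–233, Lemma 2.1 (2.60)–(2.61) pp.233–234, (2.149) p.249, (2.3) p.224, Lemma 2.4 p.245; Balaban1985Averaging, (125)–(126) p.36, (136) p.39; Balaban1985UV3, (24) p.262;
Balaban1982Higgs1, (3.24) p.616; BenfattoEtAl1978, Lemma (4.5)–(4.7) p.152 (class form; bent window, presentation and coordinates ours)] -/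
theorem eq324_CsDeltaCPstY_lettersYOfRecordV4P_sectEStYOfRecordV7_trBasis_of_b9LeafX_of_G1fam_of_pivotLines_onΛst_on_unit (N : ℕ) [NeZero N]
    (θ : Stage3Params) (hD : 2 ≤ θ.d₆ + 1) (hD3 : 3 ≤ θ.d₆ + 1) (Mstar : ℕ) (𝔡₂ : Dt2Y N θ Mstar)
    (𝔯 : ResY N θ Mstar) (𝔢₀ : SectEY N θ Mstar) (𝔢st : SectEStY N θ Mstar) (𝔴 : RWEY N θ Mstar) (𝔈 : ExpsY N θ Mstar) 
    (h06 : B9LeafX (Y9OfRecordP N θ Mstar (opsYNuStOfRecordV4PE N θ Mstar 𝔯 𝔢st 𝔴 𝔈)))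
    {γ₀ δV C₂ r₂ : ℝ} (hγ₀ : 0 < γ₀) (hδV : 0 ≤ δV) (hC₂ : 0 ≤ C₂)
    (hsmall : (θ.ℓ₆ : ℝ) * (2 * δV) < 1)
    (t D : ℕ) {ϰ : ℝ} (hϰ : 0 < ϰ) {p₀ σ' c κ' : ℝ} (hp₀ : 2 / 3 < p₀) (hσ : 0 < σ') (hc : 0 ≤ c) (hκ : 0 < κ') (hκσ : κ' < σ' * (t + 1))
    [∀ x : MemberY θ.d₆ θ.ℓ₆ θ.hd' θ.hL' θ.b₀ θ.b₁ Mstar, Fintype (geo9Y x).Site]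
    (Hg : MemberY θ.d₆ θ.ℓ₆ θ.hd' θ.hL' θ.b₀ θ.b₁ Mstar → Prop)
    (bI : ∀ x : MemberY θ.d₆ θ.ℓ₆ θ.hd' θ.hL' θ.b₀ θ.b₁ Mstar, FBondY x.toKIdx → IBondY x.toKIdx)
    (hbI0 : ∀ (x : MemberY θ.d₆ θ.ℓ₆ θ.hd' θ.hL' θ.b₀ θ.b₁ Mstar) (f : FBondY x.toKIdx), bI x f = bI x ⟨f.src, 0⟩)
    (hβ1 : ∀ (x : MemberY θ.d₆ θ.ℓ₆ θ.hd' θ.hL' θ.b₀ θ.b₁ Mstar) (f : FBondY x.toKIdx), (geomT x.D).dist (β x.hN x.D x.hk (bI x f)) (blkV1 x.hN x.D f) ≤ 1)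
    (hΔ2 : ∀ (x : MemberY θ.d₆ θ.ℓ₆ θ.hd' θ.hL' θ.b₀ θ.b₁ Mstar) (U : CfgY (Matrix (Fin N) (Fin N) ℂ) x.toKIdx),
      (∀ μ z, U μ z ∈ specialUnitaryUnits (Fin N)) → IsSymmTr (fun _ => (1 : ℝ)) ((𝔯 x).Δ2 U))
    (hG1fam : ∃ M₂ a₂ CG δG : ℝ, 0 < M₂ ∧ 0 < a₂ ∧ 0 ≤ CG ∧ 0 < δG ∧
      ∀ x : MemberY θ.d₆ θ.ℓ₆ θ.hd' θ.hL' θ.b₀ θ.b₁ Mstar, M₂ ≤ (geo9Y x).M → ∀ α₀ : ℝ, 0 < α₀ → (geo9Y x).M * α₀ ≤ a₂ →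
      ∀ U : (bg9Y (Matrix (Fin N) (Fin N) ℂ) (specialUnitaryUnits (Fin N)) x).Cfg,
        (bg9YP (Matrix (Fin N) (Fin N) ℂ) (specialUnitaryUnits (Fin N)) x).Reg335 B9PinGeometryKLevelV1.c35Y α₀ U →
        (bg9YP (Matrix (Fin N) (Fin N) ℂ) (specialUnitaryUnits (Fin N)) x).Reg336 B9PinGeometryKLevelV1.c35Y α₀ U →
          HasMajorant (g := toB6 (geo9Y x) 1 (Hg x)) (blkBK x.toKIdx (bI x))
            (GcoK x.toKIdx (trBasis N) (bg9Y (Matrix (Fin N) (Fin N) ℂ) (specialUnitaryUnits (Fin N)) x) (fun U => U)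
              (G1Y x.toKIdx (parSymY x.toKIdx) (parBY x.toKIdx) (GpPhysY x.toKIdx (parSymY x.toKIdx)) (𝔯 x).Δ2) U)
            (fun a b => CG * (geo9Y x).len a ^ 2 * Real.exp (-(δG * (geo9Y x).dist a b)))) :
    ∃ M₄ δ a₀ : ℝ, 0 < M₄ ∧ 0 < δ ∧ 0 < a₀ ∧ ∃ b₁ : ℝ, ∀ b₀ : ℝ, b₁ < b₀ → ∃ C : ℝ, 0 ≤ C ∧ ∀ η : ℝ, 0 < η → η ≤ 1 →
      ∀ (x : MemberY θ.d₆ θ.ℓ₆ θ.hd' θ.hL' θ.b₀ θ.b₁ Mstar) [DecidableEq (IBondY x.toKIdx)], M₄ ≤ (geo9Y x).M →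
      ∀ α₀ : ℝ, 0 < α₀ → (geo9Y x).M * α₀ ≤ a₀ →
      ∀ (U : CfgY (Matrix (Fin N) (Fin N) ℂ) x.toKIdx),
        (bg9YP (Matrix (Fin N) (Fin N) ℂ) (specialUnitaryUnits (Fin N)) x).Reg335 B9PinGeometryKLevelV1.c35Y α₀ U →
        (bg9YP (Matrix (Fin N) (Fin N) ℂ) (specialUnitaryUnits (Fin N)) x).Reg336 B9PinGeometryKLevelV1.c35Y α₀ U →
        (∀ c' : CBondStY x, ¬ GoodY x c'.1.1 → ∀ i : ℕ, i < θ.ℓ₆ →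
          ‖((avYOfRecord x U ⟨ofZ x (labK x c'.1.1 + (i : ℤ) • unitVec c'.1.2), c'.1.2⟩ : (Matrix (Fin N) (Fin N) ℂ)ˣ) :
              Matrix (Fin N) (Fin N) ℂ) - 1‖ ≤ δV) →
        IsSymmTr (fun _ => (1 : ℝ)) ((𝔢₀ x).D2J U) →
      ∀ {σ : Type} [Fintype σ] [DecidableEq σ] [Nonempty σ] (ι : σ → IBondY x.toKIdx), Function.Injective ι → (∀ s, lamTstY x (ι s)) →
        (𝔢₀ x).D2J U = d2JOfY (trDualMatY N) x.toKIdx (parSymY x.toKIdx) (parBY x.toKIdx) (GpPhysY x.toKIdx (parSymY x.toKIdx)) (𝔯 x).Δ2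
          (𝔡₂ x).form U →
        (∀ (u v : IBondY x.toKIdx) (E a : Matrix (Fin N) (Fin N) ℂ), r₂ < unitDistY x u v → (𝔡₂ x).form U (Pi.single v E) (Pi.single u a) = 0) →
        (∀ (u v : IBondY x.toKIdx) (E a : Matrix (Fin N) (Fin N) ℂ), ∑ z, ‖(𝔡₂ x).form U (Pi.single v E) (Pi.single u a) z‖ ≤ C₂ * ‖E‖ * ‖a‖) →
        (∀ B : IBondY x.toKIdx → Matrix (Fin N) (Fin N) ℂ, (∀ q, ¬ inΛstY x q → B q = 0) → (∀ q, IsAxialY x q → B q = 0) →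
          (∀ c' : CBondStY x, Q1Y x (avYOfRecord x) U c'.1 B = 0) →
          γ₀ * trIP (fun _ => (1 : ℝ)) B B ≤
            trIP (fun _ => (1 : ℝ)) B (deltaKPstY x (lettersYOfRecordV4P N θ Mstar 𝔯 x) (sectEStYOfRecordV7 N θ Mstar 𝔢₀ x) U B)) →
      ∃ (Λ : Finset (B1Eq324BenfattoLemma.Site (θ.d₆ + 1 + (θ.d₆ + 1) + 1))) (e' : σ × TrIdx N ≃ ↥Λ),
        ((gaussianFieldOfKernel fun u w => if h : u ∈ Λ ∧ w ∈ Λ then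
            ((Matrix.reindex e' e'
              (Matrix.of fun p q : σ × TrIdx N =>
                  trReForm (trBasis N p.2) (((CsDeltaCPstY x (lettersYOfRecordV4P N θ Mstar 𝔯 x)
            (sectEStYOfRecordV7 N θ Mstar 𝔢₀ x) U).restrictScalars ℝ)
                    (Pi.single (ι q.1) (trBasis N q.2)) (ι p.1))))⁻¹ :
                Matrix ↥Λ ↥Λ ℝ) ⟨u, h.1⟩ ⟨w, h.2⟩ else 0).map
            (fun (z : B1Eq324BenfattoLemma.Site (θ.d₆ + 1 + (θ.d₆ + 1) + 1) → ℝ) (q : σ × TrIdx N) => z ((e' q : ↥Λ) : B1Eq324BenfattoLemma.Site (θ.d₆ + 1 + (θ.d₆ + 1) + 1))) =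
          gaussianFieldOfKernel fun p q =>
            ((Matrix.of fun p q : σ × TrIdx N =>
                trReForm (trBasis N p.2) (((CsDeltaCPstY x (lettersYOfRecordV4P N θ Mstar 𝔯 x)
            (sectEStYOfRecordV7 N θ Mstar 𝔢₀ x) U).restrictScalars ℝ)
                  (Pi.single (ι q.1) (trBasis N q.2)) (ι p.1)))⁻¹ :
              Matrix (σ × TrIdx N) (σ × TrIdx N) ℝ) p q) ∧
        (∀ p : ℝ, 0 ≤ p →
          ((fun (z : B1Eq324BenfattoLemma.Site (θ.d₆ + 1 + (θ.d₆ + 1) + 1) → ℝ) (q : σ × TrIdx N) => z ((e' q : ↥Λ) : B1Eq324BenfattoLemma.Site (θ.d₆ + 1 + (θ.d₆ + 1) + 1))) ⁻¹'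
              {ω : σ × TrIdx N → ℝ | ∀ q, |ω q| ≤ p}) =ᵐ[gaussianFieldOfKernel fun u w => if h : u ∈ Λ ∧ w ∈ Λ then
                ((Matrix.reindex e' e'
                  (Matrix.of fun p q : σ × TrIdx N =>
                      trReForm (trBasis N p.2) (((CsDeltaCPstY x (lettersYOfRecordV4P N θ Mstar 𝔯 x)
            (sectEStYOfRecordV7 N θ Mstar 𝔢₀ x) U).restrictScalars ℝ)
                        (Pi.single (ι q.1) (trBasis N q.2)) (ι p.1))))⁻¹ :
                    Matrix ↥Λ ↥Λ ℝ) ⟨u, h.1⟩ ⟨w, h.2⟩ else 0]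
            smallFieldSet Λ p) ∧
        ∀ (s : ℕ) (I J : Finset (B1Eq324BenfattoLemma.Site (θ.d₆ + 1 + (θ.d₆ + 1) + 1))) (𝔞 : Coef (θ.d₆ + 1 + (θ.d₆ + 1) + 1)),
          I.Nonempty → J ⊆ I → J ⊆ Λ → coefSup s D 𝔞 J ≤ c * η ^ σ' →
          0 < ∫ z, cutoffBoltzmann (hamiltonian s D ϰ 𝔞 J) I (B10.pFun b₀ p₀ η) z ∂(gaussianFieldOfKernel fun u w => if h : u ∈ Λ ∧ w ∈ Λ then
              ((Matrix.reindex e' e'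
                (Matrix.of fun p q : σ × TrIdx N =>
                    trReForm (trBasis N p.2) (((CsDeltaCPstY x (lettersYOfRecordV4P N θ Mstar 𝔯 x)
            (sectEStYOfRecordV7 N θ Mstar 𝔢₀ x) U).restrictScalars ℝ)
                      (Pi.single (ι q.1) (trBasis N q.2)) (ι p.1))))⁻¹ :
                  Matrix ↥Λ ↥Λ ℝ) ⟨u, h.1⟩ ⟨w, h.2⟩ else 0) ∧
            |Real.log (∫ z, cutoffBoltzmann (hamiltonian s D ϰ 𝔞 J) I (B10.pFun b₀ p₀ η) z ∂(gaussianFieldOfKernel fun u w =>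
                if h : u ∈ Λ ∧ w ∈ Λ then
                  ((Matrix.reindex e' e'
                    (Matrix.of fun p q : σ × TrIdx N =>
                        trReForm (trBasis N p.2) (((CsDeltaCPstY x (lettersYOfRecordV4P N θ Mstar 𝔯 x)
            (sectEStYOfRecordV7 N θ Mstar 𝔢₀ x) U).restrictScalars ℝ)
                          (Pi.single (ι q.1) (trBasis N q.2)) (ι p.1))))⁻¹ :
                      Matrix ↥Λ ↥Λ ℝ) ⟨u, h.1⟩ ⟨w, h.2⟩ else 0)) -
              cumulantSum (gaussianFieldOfKernel fun u w => if h : u ∈ Λ ∧ w ∈ Λ then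
                  ((Matrix.reindex e' e'
                    (Matrix.of fun p q : σ × TrIdx N =>
                        trReForm (trBasis N p.2) (((CsDeltaCPstY x (lettersYOfRecordV4P N θ Mstar 𝔯 x)
            (sectEStYOfRecordV7 N θ Mstar 𝔢₀ x) U).restrictScalars ℝ)
                          (Pi.single (ι q.1) (trBasis N q.2)) (ι p.1))))⁻¹ :
                      Matrix ↥Λ ↥Λ ℝ) ⟨u, h.1⟩ ⟨w, h.2⟩ else 0)
                (hamiltonian s D ϰ 𝔞 J) t| ≤ C * η ^ κ' * I.card := by
  classical
  have hN : 0 < N := Nat.pos_of_ne_zero (NeZero.ne N)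
  have hL1 : (1 : ℝ) ≤ ((θ.ℓ₆ + 1 : ℕ) : ℝ) := by exact_mod_cast Nat.succ_le_succ (Nat.zero_le _)
  have hL0 : (0 : ℝ) < ((θ.ℓ₆ + 1 : ℕ) : ℝ) := lt_of_lt_of_le one_pos hL1
  -- row 26 of the certificate: the (3.132) kernel of `(QG₁Q*)⁻¹[G′_phys, Δ⁽²⁾]`, member-uniformly
  obtain ⟨M₄', δ₁, a₀', C, hM₄', hδ₁, ha₀', hC, h26x⟩ := h06.s3132
  -- Thm 3.12's (3.42)₁ letter for `G₁`
  obtain ⟨M₂, a₂, CG, δG, hM₂, ha₂, hCG, hδG, hGx⟩ := hG1fam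
  -- the internal rates and the PinPrims record
  set δq : ℝ := min (δ₁ / 2) δG with hδq_def
  have hδq : 0 < δq := lt_min (by linarith) hδG
  have hδq₁ : δq ≤ δ₁ / 2 := min_le_left _ _
  have hδqG : δq ≤ δG := min_le_right _ _
  let q : PinPrims := ⟨1 / 4, 0, 0, 0, 0, 1, 0, 0, 1, δq, 1, 1, 1 / 4, 0, 0, 0, 0, 0, 0, 0, fun _ => 0, fun _ => 0, fun _ => 0, fun _ => 0, fun _ _ => 0⟩
  have hq : q.OK :=
    { α_pos := by norm_num [q], α_lt := by norm_num [q], Nc_nn := le_rfl, N'_nn := le_rfl, NF_nn := le_rfl, one_le_Cℓ := le_rfl,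
      Kc_nn := le_rfl, θ₀_nn := le_rfl, B₀_pos := one_pos, δ₀_pos := hδq, a₁_pos := one_pos, M₁_pos := one_pos,
      αF_pos := by norm_num [q], αF_lt := by norm_num [q], NH_nn := le_rfl, NL_nn := le_rfl, BL_nn := le_rfl, NI_nn := le_rfl,
      N2_nn := le_rfl, B2_nn := le_rfl, θ2_nn := le_rfl, Bl_nn := fun _ _ _ => le_rfl, Bt_nn := fun _ _ _ => le_rfl,
      BI_nn := fun _ _ _ => le_rfl, BI2_nn := fun _ _ _ _ _ _ => le_rfl, θI_nn := fun _ _ => le_rfl }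
  have hqα : q.α = 1 / 4 := rfl
  have hqαF : q.αF = 1 / 4 := rfl
  have hqδ : q.δ₀ = δq := rfl
  -- the road constants
  set ρR : ℝ := 5 / 8 * δq with hρR_def
  have hρR : 0 < ρR := by positivity
  have hρ : q.αF * ((1 - 2 * q.α) * q.δ₀) + ρR ≤ (1 - q.α) * q.δ₀ := by rw [hqα, hqαF, hqδ, hρR_def]; linarith
  set rC : ℝ := max (cR39 (trBasis N) * (coordBound39 (trBasis N) * basisBound39 (trBasis N)) * C * (((θ.ℓ₆ + 1 : ℕ) : ℝ)) ^ 2) 0 with hrC_def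
  have hrC : 0 ≤ rC := le_max_right _ _
  have hB₃ : cR39 (trBasis N) * (coordBound39 (trBasis N) * basisBound39 (trBasis N)) * C * (((θ.ℓ₆ + 1 : ℕ) : ℝ)) ^ 2 ≤ rC := le_max_left _ _
  set aT : ℝ := min a₀' (min a₂ (10 * ((θ.ℓ₆ + 1 : ℕ) : ℝ) ^ 7)⁻¹) with haT_def
  have haT : 0 < aT := lt_min ha₀' (lt_min ha₂ (inv_pos.mpr (by positivity)))
  have haT₀ : aT ≤ a₀' := min_le_left _ _
  have haT₂ : aT ≤ a₂ := (min_le_right _ _).trans (min_le_left _ _)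
  have ha1 : 10 * ((θ.ℓ₆ + 1 : ℕ) : ℝ) ^ 7 * aT ≤ 1 := by
    have h1 : aT ≤ (10 * ((θ.ℓ₆ + 1 : ℕ) : ℝ) ^ 7)⁻¹ := (min_le_right _ _).trans (min_le_right _ _)
    have h2 : (0 : ℝ) < 10 * ((θ.ℓ₆ + 1 : ℕ) : ℝ) ^ 7 := by positivity
    calc 10 * ((θ.ℓ₆ + 1 : ℕ) : ℝ) ^ 7 * aT ≤ 10 * ((θ.ℓ₆ + 1 : ℕ) : ℝ) ^ 7 * (10 * ((θ.ℓ₆ + 1 : ℕ) : ℝ) ^ 7)⁻¹ := mul_le_mul_of_nonneg_left h1 h2.le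
      _ = 1 := mul_inv_cancel₀ h2.ne'
  -- the (3.132) → class → raw threshold: `2 log L ≤ (δ₁ − δ₁/2)·(2L² − 1)·M`
  set MC : ℝ := 2 * Real.log (((θ.ℓ₆ + 1 : ℕ) : ℝ)) / ((δ₁ - δ₁ / 2) * (2 * ((θ.ℓ₆ : ℝ) + 1) ^ 2 - 1)) with hMC_def
  have hden : 0 < (δ₁ - δ₁ / 2) * (2 * ((θ.ℓ₆ : ℝ) + 1) ^ 2 - 1) := by
    have h1 : 0 < δ₁ - δ₁ / 2 := by linarith
    have h2 : (1 : ℝ) ≤ ((θ.ℓ₆ : ℝ) + 1) ^ 2 := one_le_pow₀ (by linarith [(Nat.cast_nonneg θ.ℓ₆ : (0 : ℝ) ≤ θ.ℓ₆)])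
    exact mul_pos h1 (by linarith)
  set MT : ℝ := max M₄' (max M₂ MC) with hMT_def
  have hMT : 0 < MT := lt_max_of_lt_left hM₄'
  -- §A the raw (3.132) letter for `C₁` at the block count, rate `δq`, from row 26 (dag-n06-i's bridge + n06-w5's raw reading + the block-count dictionary)
  have hC1raw : ∀ x : B9PinMembersKLevelV1.MemberY θ.d₆ θ.ℓ₆ θ.hd' θ.hL' θ.b₀ θ.b₁ Mstar, MT ≤ (geo9Y x).M → ∀ α₀ : ℝ, 0 < α₀ → (geo9Y x).M * α₀ ≤ aT →
      ∀ U : (bg9Y (Matrix (Fin N) (Fin N) ℂ) (specialUnitaryUnits (Fin N)) x).Cfg,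
        (bg9YP (Matrix (Fin N) (Fin N) ℂ) (specialUnitaryUnits (Fin N)) x).Reg335 B9PinGeometryKLevelV1.c35Y α₀ U →
        (bg9YP (Matrix (Fin N) (Fin N) ℂ) (specialUnitaryUnits (Fin N)) x).Reg336 B9PinGeometryKLevelV1.c35Y α₀ U →
          HasMajorantHom (g := toB6 (geo9Y x) 1 (Hg x)) (blkHK x.toKIdx) (blkHK x.toKIdx)
            (C1coK x.toKIdx (trBasis N) (bg9Y (Matrix (Fin N) (Fin N) ℂ) (specialUnitaryUnits (Fin N)) x) (fun U => U)
              (parSymY x.toKIdx) (parBY x.toKIdx) (GpPhysY x.toKIdx (parSymY x.toKIdx)) (𝔯 x).Δ2 U)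
            (fun a b => rC * ((geo9Y x).len a / etaBY x.toKIdx) ^ (θ.d₆ + 1) * ((geo9Y x).len b ^ 2)⁻¹ * Real.exp (-(q.δ₀ * (geo9Y x).dist a b))) := by
    intro x hMx α₀ hα ha U hU hU'
    letI : Fintype (geo9K x.toKIdx).Site := (inferInstance : Fintype (geo9Y x).Site)
    have hM₄x : M₄' ≤ (geo9Y x).M := (le_max_left _ _).trans hMx
    have hMCx : MC ≤ (geo9Y x).M := ((le_max_right _ _).trans (le_max_right M₄' _)).trans hMx
    have ha₀x : (geo9Y x).M * α₀ ≤ a₀' := ha.trans haT₀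
    have h26₁ : B9.Ineq3132 (θ.d₆ + 1)
        (siteKernelOfOpNu x.toKIdx (bg9Y (Matrix (Fin N) (Fin N) ℂ) (specialUnitaryUnits (Fin N)) x) (fun U => U) (nuY (θ.d₆ + 1) x.toKIdx)
          (QG1QinvY x.toKIdx (parSymY x.toKIdx) (parBY x.toKIdx) (GpPhysY x.toKIdx (parSymY x.toKIdx)) (𝔯 x).Δ2)) C δ₁ U :=
      (h26x x hM₄x α₀ hα ha₀x U hU hU').2
    have hM : 2 * Real.log (((θ.ℓ₆ + 1 : ℕ) : ℝ)) ≤ (δ₁ - δ₁ / 2) * (2 * ((θ.ℓ₆ : ℝ) + 1) ^ 2 - 1) * (geo9Y x).M := by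
      have := (div_le_iff₀ hden).mp hMCx
      linarith [this]
    have hpl : ∀ y : (geo9Y x).Site, 0 ≤ (((((θ.ℓ₆ + 1 : ℕ) : ℝ)) ^ (θ.d₆ + 1)) ^ (lvl x.hN x.D x.hk y))⁻¹ := fun y => by positivity
    have hpl' : ∀ y : (geo9Y x).Site, 0 < (((((θ.ℓ₆ + 1 : ℕ) : ℝ)) ^ (θ.d₆ + 1)) ^ (lvl x.hN x.D x.hk y))⁻¹ := fun y => by positivity
    -- dag-n06-i's bridge: the `𝔠⁽²⁾ → Z_{n⁻¹}` class letter of `C₁` at rate `δ₁/2`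
    have hcls : HasMaj (cNorm 1 (Hg x) (blkHK x.toKIdx) (fun y => (geo9Y_len_pos x y).le) 2)
        (weightNorm (BlockNorm.ofBlocks (toB6 (geo9Y x) 1 (Hg x)) (blkHK x.toKIdx))
          (fun y => (((((θ.ℓ₆ + 1 : ℕ) : ℝ)) ^ (θ.d₆ + 1)) ^ (lvl x.hN x.D x.hk y))⁻¹) hpl)
        (C1coK x.toKIdx (trBasis N) (bg9Y (Matrix (Fin N) (Fin N) ℂ) (specialUnitaryUnits (Fin N)) x) (fun U => U)
          (parSymY x.toKIdx) (parBY x.toKIdx) (GpPhysY x.toKIdx (parSymY x.toKIdx)) (𝔯 x).Δ2 U)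
        (fun a b' => rC * Real.exp (-(δ₁ / 2 * (geo9Y x).dist a b'))) := by
      have h := hasMaj_cNorm_weightNorm_coordOpK_geo9Y_of_ineq3132Nu (trBasis N) x
        (bg9Y (Matrix (Fin N) (Fin N) ℂ) (specialUnitaryUnits (Fin N)) x) (fun U => U)
        (QG1QinvY x.toKIdx (parSymY x.toKIdx) (parBY x.toKIdx) (GpPhysY x.toKIdx (parSymY x.toKIdx)) (𝔯 x).Δ2)
        (norm_nonneg _) (abs_repr_le (trBasis N)) 1 (Hg x) (cR39 (trBasis N)) U (fun y => (geo9Y_len_pos x y).le) hpl hC.le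
        (show δ₁ / 2 < δ₁ by linarith) hM h26₁
      exact h.mono fun a b' => mul_le_mul_of_nonneg_right (const3132_le hB₃) (Real.exp_nonneg _)
    -- n06-w5's raw two-variable reading, then the block-count dictionary and the rate `δq ≤ δ₁/2`
    have hGeo : GeoOK (geo9Y x) := ⟨geo9Y_dist_triangle x, geo9Y_dist_comm x, geo9K_dist_nonneg x.toKIdx, geo9Y_len_pos x⟩
    have hraw := hasMajorantHom_raw_of_hasMaj_cNorm_weightNorm (R₀ := (1 : ℝ)) (H₀ := Hg x) hGeo
      (fun a b' => mul_nonneg hrC (Real.exp_nonneg _)) hpl' hcls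
    refine B6RandomWalkHom.hasMajorantHom_mono _ _ hraw fun a b' => ?_
    have hn : ((((((θ.ℓ₆ + 1 : ℕ) : ℝ)) ^ (θ.d₆ + 1)) ^ (lvl x.hN x.D x.hk a))⁻¹)⁻¹ = ((geo9Y x).len a / etaBY x.toKIdx) ^ (θ.d₆ + 1) := by
      rw [inv_inv, blockCount_eq_pow_lvl]
    have hd0 : 0 ≤ (geo9Y x).dist a b' := geo9K_dist_nonneg x.toKIdx a b'
    have hexp : Real.exp (-(δ₁ / 2 * (geo9Y x).dist a b')) ≤ Real.exp (-(q.δ₀ * (geo9Y x).dist a b')) := by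
      rw [hqδ]
      have h1 : δq * (geo9Y x).dist a b' ≤ δ₁ / 2 * (geo9Y x).dist a b' := mul_le_mul_of_nonneg_right hδq₁ hd0
      exact Real.exp_le_exp.mpr (neg_le_neg h1)
    have hnn : 0 ≤ ((geo9Y x).len a / etaBY x.toKIdx) ^ (θ.d₆ + 1) * ((geo9Y x).len b' ^ 2)⁻¹ :=
      mul_nonneg (pow_nonneg (div_nonneg (geo9Y_len_pos x a).le (etaBY_pos' x).le) _) (inv_nonneg.mpr (sq_nonneg _))
    rw [hn]
    calc rC * Real.exp (-(δ₁ / 2 * (geo9Y x).dist a b')) * (((geo9Y x).len a / etaBY x.toKIdx) ^ (θ.d₆ + 1) * ((geo9Y x).len b' ^ 2)⁻¹)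
        ≤ rC * Real.exp (-(q.δ₀ * (geo9Y x).dist a b')) * (((geo9Y x).len a / etaBY x.toKIdx) ^ (θ.d₆ + 1) * ((geo9Y x).len b' ^ 2)⁻¹) :=
          mul_le_mul_of_nonneg_right (mul_le_mul_of_nonneg_left hexp hrC) hnn
      _ = rC * ((geo9Y x).len a / etaBY x.toKIdx) ^ (θ.d₆ + 1) * ((geo9Y x).len b' ^ 2)⁻¹ * Real.exp (-(q.δ₀ * (geo9Y x).dist a b')) := by ring
  -- §B `G₁`'s (3.42)₁ letter at the road's rate `(1 − α)δq ≤ δG`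
  have hG1e0 : ∀ x : B9PinMembersKLevelV1.MemberY θ.d₆ θ.ℓ₆ θ.hd' θ.hL' θ.b₀ θ.b₁ Mstar, MT ≤ (geo9Y x).M → ∀ α₀ : ℝ, 0 < α₀ → (geo9Y x).M * α₀ ≤ aT →
      ∀ U : (bg9Y (Matrix (Fin N) (Fin N) ℂ) (specialUnitaryUnits (Fin N)) x).Cfg,
        (bg9YP (Matrix (Fin N) (Fin N) ℂ) (specialUnitaryUnits (Fin N)) x).Reg335 B9PinGeometryKLevelV1.c35Y α₀ U →
        (bg9YP (Matrix (Fin N) (Fin N) ℂ) (specialUnitaryUnits (Fin N)) x).Reg336 B9PinGeometryKLevelV1.c35Y α₀ U →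
          HasMajorant (g := toB6 (geo9Y x) 1 (Hg x)) (blkBK x.toKIdx (bI x))
            (GcoK x.toKIdx (trBasis N) (bg9Y (Matrix (Fin N) (Fin N) ℂ) (specialUnitaryUnits (Fin N)) x) (fun U => U)
              (G1Y x.toKIdx (parSymY x.toKIdx) (parBY x.toKIdx) (GpPhysY x.toKIdx (parSymY x.toKIdx)) (𝔯 x).Δ2) U)
            (fun a b => CG * (geo9Y x).len a ^ 2 * Real.exp (-((1 - q.α) * q.δ₀ * (geo9Y x).dist a b))) := by
    intro x hMx α₀ hα ha U hU hU'
    have hM₂x : M₂ ≤ (geo9Y x).M := ((le_max_left _ _).trans (le_max_right M₄' _)).trans hMx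
    have h := hGx x hM₂x α₀ hα (ha.trans haT₂) U hU hU'
    rw [← B6RandomWalkHom.hasMajorantHom_iff] at h ⊢
    refine B6RandomWalkHom.hasMajorantHom_mono _ _ h fun a b' => ?_
    have hd0 : 0 ≤ (geo9Y x).dist a b' := geo9K_dist_nonneg x.toKIdx a b'
    have hexp : Real.exp (-(δG * (geo9Y x).dist a b')) ≤ Real.exp (-((1 - q.α) * q.δ₀ * (geo9Y x).dist a b')) := by
      rw [hqα, hqδ]
      have h0 : (1 - 1 / 4) * δq ≤ δG := by linarith
      have h1 : (1 - 1 / 4) * δq * (geo9Y x).dist a b' ≤ δG * (geo9Y x).dist a b' := mul_le_mul_of_nonneg_right h0 hd0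
      exact Real.exp_le_exp.mpr (neg_le_neg h1)
    exact mul_le_mul_of_nonneg_left hexp (mul_nonneg hCG (sq_nonneg _))
  -- §C the cancelling-road door at the internal record
  exact eq324_CsDeltaCPstY_lettersYOfRecordV4P_sectEStYOfRecordV7_trBasis_of_b9LeafX_of_G1e0C1rawLetters_of_pivotLines_onΛst_on_unit N θ hD hD3 Mstar 𝔡₂ 𝔯 𝔢₀ 𝔢st 𝔴 𝔈 h06
    hγ₀ hδV hC₂ hsmall t D hϰ hp₀ hσ hc hκ hκσ q hq Hg bI hbI0 hβ1 CG rC ρR _ MT aT hCG hrC hρR hMT haT ha1 hρ le_rfl hΔ2 hG1e0 hC1raw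


/-- ★★★★★ **THE `_ofC2` TWIN over `𝔯 := resYOfC2 𝔠`** ([5]'s `C⁽²⁾`; `Δ⁽²⁾`'s symmetry from the global reality row `hCr` via def-Y's `resYOfC2_Δ2_isSymmTr_real` inside
`…AdjCurrentCancel` §2) — node-N06-side binders EXACTLY `h06` + `hG1fam`; [5]-side `hCr`; the IDENT's starting point in this currency.
[cite: Balaban1985BackgroundPropagators, p.422 (the sentence between (3.136) and (3.137)), (3.42) p.397, p.398 (remark after (3.47)), (3.123) p.420, (3.128)–(3.129) p.421,
(3.132)–(3.134) p.422, Thm 3.11 p.416, Thm 3.12 p.423, (3.35)–(3.36) p.396, (3.155)–(3.158) pp.427–428, Thms 3.1–3.15 pp.397–432 (the leaf); Balaban1984PropagatorsII, (2.1) p.224,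
(2.51)–(2.56) pp.232–233, Lemma 2.1 (2.60)–(2.61) pp.233–234, (2.149) p.249, (2.3) p.224, Lemma 2.4 p.245; Balaban1985Averaging, (125)–(126) p.36, (136) p.39; Balaban1985UV3,
(24) p.262; Balaban1982Higgs1, (3.24) p.616; BenfattoEtAl1978, Lemma (4.5)–(4.7) p.152 (class form; bent window, presentation and coordinates ours)] -/
theorem eq324_CsDeltaCPstY_lettersYOfRecordV4P_sectEStYOfRecordV7_trBasis_of_b9LeafX_of_G1fam_of_pivotLines_ofC2_onΛst_on_unit (N : ℕ) [NeZero N]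
    (θ : Stage3Params) (hD : 2 ≤ θ.d₆ + 1) (hD3 : 3 ≤ θ.d₆ + 1) (Mstar : ℕ) (𝔠 : C2Y N θ Mstar) (𝔡₂ : Dt2Y N θ Mstar)
    (𝔢₀ : SectEY N θ Mstar) (𝔢st : SectEStY N θ Mstar) (𝔴 : RWEY N θ Mstar) (𝔈 : ExpsY N θ Mstar) 
    (h06 : B9LeafX (Y9OfRecordP N θ Mstar (opsYNuStOfRecordV4PE N θ Mstar (resYOfC2 N θ Mstar 𝔠) 𝔢st 𝔴 𝔈)))
    {γ₀ δV C₂ r₂ : ℝ} (hγ₀ : 0 < γ₀) (hδV : 0 ≤ δV) (hC₂ : 0 ≤ C₂)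
    (hsmall : (θ.ℓ₆ : ℝ) * (2 * δV) < 1)
    (t D : ℕ) {ϰ : ℝ} (hϰ : 0 < ϰ) {p₀ σ' c κ' : ℝ} (hp₀ : 2 / 3 < p₀) (hσ : 0 < σ') (hc : 0 ≤ c) (hκ : 0 < κ') (hκσ : κ' < σ' * (t + 1))
    [∀ x : MemberY θ.d₆ θ.ℓ₆ θ.hd' θ.hL' θ.b₀ θ.b₁ Mstar, Fintype (geo9Y x).Site]
    (Hg : MemberY θ.d₆ θ.ℓ₆ θ.hd' θ.hL' θ.b₀ θ.b₁ Mstar → Prop)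
    (bI : ∀ x : MemberY θ.d₆ θ.ℓ₆ θ.hd' θ.hL' θ.b₀ θ.b₁ Mstar, FBondY x.toKIdx → IBondY x.toKIdx)
    (hbI0 : ∀ (x : MemberY θ.d₆ θ.ℓ₆ θ.hd' θ.hL' θ.b₀ θ.b₁ Mstar) (f : FBondY x.toKIdx), bI x f = bI x ⟨f.src, 0⟩)
    (hβ1 : ∀ (x : MemberY θ.d₆ θ.ℓ₆ θ.hd' θ.hL' θ.b₀ θ.b₁ Mstar) (f : FBondY x.toKIdx), (geomT x.D).dist (β x.hN x.D x.hk (bI x f)) (blkV1 x.hN x.D f) ≤ 1)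
    (hCr : ∀ (x : MemberY θ.d₆ θ.ℓ₆ θ.hd' θ.hL' θ.b₀ θ.b₁ Mstar) (U : CfgY (Matrix (Fin N) (Fin N) ℂ) x.toKIdx) (A A' : FBondY x.toKIdx → Matrix (Fin N) (Fin N) ℂ),
      (∀ μ z, U μ z ∈ specialUnitaryUnits (Fin N)) → (𝔠 x).form U (star A) (star A') = star ((𝔠 x).form U A A'))
    (hG1fam : ∃ M₂ a₂ CG δG : ℝ, 0 < M₂ ∧ 0 < a₂ ∧ 0 ≤ CG ∧ 0 < δG ∧
      ∀ x : MemberY θ.d₆ θ.ℓ₆ θ.hd' θ.hL' θ.b₀ θ.b₁ Mstar, M₂ ≤ (geo9Y x).M → ∀ α₀ : ℝ, 0 < α₀ → (geo9Y x).M * α₀ ≤ a₂ →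
      ∀ U : (bg9Y (Matrix (Fin N) (Fin N) ℂ) (specialUnitaryUnits (Fin N)) x).Cfg,
        (bg9YP (Matrix (Fin N) (Fin N) ℂ) (specialUnitaryUnits (Fin N)) x).Reg335 B9PinGeometryKLevelV1.c35Y α₀ U →
        (bg9YP (Matrix (Fin N) (Fin N) ℂ) (specialUnitaryUnits (Fin N)) x).Reg336 B9PinGeometryKLevelV1.c35Y α₀ U →
          HasMajorant (g := toB6 (geo9Y x) 1 (Hg x)) (blkBK x.toKIdx (bI x))
            (GcoK x.toKIdx (trBasis N) (bg9Y (Matrix (Fin N) (Fin N) ℂ) (specialUnitaryUnits (Fin N)) x) (fun U => U)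
              (G1Y x.toKIdx (parSymY x.toKIdx) (parBY x.toKIdx) (GpPhysY x.toKIdx (parSymY x.toKIdx)) (resYOfC2 N θ Mstar 𝔠 x).Δ2) U)
            (fun a b => CG * (geo9Y x).len a ^ 2 * Real.exp (-(δG * (geo9Y x).dist a b)))) :
    ∃ M₄ δ a₀ : ℝ, 0 < M₄ ∧ 0 < δ ∧ 0 < a₀ ∧ ∃ b₁ : ℝ, ∀ b₀ : ℝ, b₁ < b₀ → ∃ C : ℝ, 0 ≤ C ∧ ∀ η : ℝ, 0 < η → η ≤ 1 →
      ∀ (x : MemberY θ.d₆ θ.ℓ₆ θ.hd' θ.hL' θ.b₀ θ.b₁ Mstar) [DecidableEq (IBondY x.toKIdx)], M₄ ≤ (geo9Y x).M →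
      ∀ α₀ : ℝ, 0 < α₀ → (geo9Y x).M * α₀ ≤ a₀ →
      ∀ (U : CfgY (Matrix (Fin N) (Fin N) ℂ) x.toKIdx),
        (bg9YP (Matrix (Fin N) (Fin N) ℂ) (specialUnitaryUnits (Fin N)) x).Reg335 B9PinGeometryKLevelV1.c35Y α₀ U →
        (bg9YP (Matrix (Fin N) (Fin N) ℂ) (specialUnitaryUnits (Fin N)) x).Reg336 B9PinGeometryKLevelV1.c35Y α₀ U →
        (∀ c' : CBondStY x, ¬ GoodY x c'.1.1 → ∀ i : ℕ, i < θ.ℓ₆ →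
          ‖((avYOfRecord x U ⟨ofZ x (labK x c'.1.1 + (i : ℤ) • unitVec c'.1.2), c'.1.2⟩ : (Matrix (Fin N) (Fin N) ℂ)ˣ) :
              Matrix (Fin N) (Fin N) ℂ) - 1‖ ≤ δV) →
        (∀ B B' : IBondY x.toKIdx → Matrix (Fin N) (Fin N) ℂ, (𝔡₂ x).form U (star B) (star B') = star ((𝔡₂ x).form U B B')) →
      ∀ {σ : Type} [Fintype σ] [DecidableEq σ] [Nonempty σ] (ι : σ → IBondY x.toKIdx), Function.Injective ι → (∀ s, lamTstY x (ι s)) →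
        (𝔢₀ x).D2J U = d2JOfY (trDualMatY N) x.toKIdx (parSymY x.toKIdx) (parBY x.toKIdx) (GpPhysY x.toKIdx (parSymY x.toKIdx)) (resYOfC2 N θ Mstar 𝔠 x).Δ2
          (𝔡₂ x).form U →
        (∀ (u v : IBondY x.toKIdx) (E a : Matrix (Fin N) (Fin N) ℂ), r₂ < unitDistY x u v → (𝔡₂ x).form U (Pi.single v E) (Pi.single u a) = 0) →
        (∀ (u v : IBondY x.toKIdx) (E a : Matrix (Fin N) (Fin N) ℂ), ∑ z, ‖(𝔡₂ x).form U (Pi.single v E) (Pi.single u a) z‖ ≤ C₂ * ‖E‖ * ‖a‖) →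
        (∀ B : IBondY x.toKIdx → Matrix (Fin N) (Fin N) ℂ, (∀ q, ¬ inΛstY x q → B q = 0) → (∀ q, IsAxialY x q → B q = 0) →
          (∀ c' : CBondStY x, Q1Y x (avYOfRecord x) U c'.1 B = 0) →
          γ₀ * trIP (fun _ => (1 : ℝ)) B B ≤
            trIP (fun _ => (1 : ℝ)) B (deltaKPstY x (lettersYOfRecordV4P N θ Mstar (resYOfC2 N θ Mstar 𝔠) x) (sectEStYOfRecordV7 N θ Mstar 𝔢₀ x) U B)) →
      ∃ (Λ : Finset (B1Eq324BenfattoLemma.Site (θ.d₆ + 1 + (θ.d₆ + 1) + 1))) (e' : σ × TrIdx N ≃ ↥Λ),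
        ((gaussianFieldOfKernel fun u w => if h : u ∈ Λ ∧ w ∈ Λ then
            ((Matrix.reindex e' e'
              (Matrix.of fun p q : σ × TrIdx N =>
                  trReForm (trBasis N p.2) (((CsDeltaCPstY x (lettersYOfRecordV4P N θ Mstar (resYOfC2 N θ Mstar 𝔠) x)
            (sectEStYOfRecordV7 N θ Mstar 𝔢₀ x) U).restrictScalars ℝ)
                    (Pi.single (ι q.1) (trBasis N q.2)) (ι p.1))))⁻¹ :
                Matrix ↥Λ ↥Λ ℝ) ⟨u, h.1⟩ ⟨w, h.2⟩ else 0).map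
            (fun (z : B1Eq324BenfattoLemma.Site (θ.d₆ + 1 + (θ.d₆ + 1) + 1) → ℝ) (q : σ × TrIdx N) => z ((e' q : ↥Λ) : B1Eq324BenfattoLemma.Site (θ.d₆ + 1 + (θ.d₆ + 1) + 1))) =
          gaussianFieldOfKernel fun p q =>
            ((Matrix.of fun p q : σ × TrIdx N =>
                trReForm (trBasis N p.2) (((CsDeltaCPstY x (lettersYOfRecordV4P N θ Mstar (resYOfC2 N θ Mstar 𝔠) x)
            (sectEStYOfRecordV7 N θ Mstar 𝔢₀ x) U).restrictScalars ℝ)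
                  (Pi.single (ι q.1) (trBasis N q.2)) (ι p.1)))⁻¹ :
              Matrix (σ × TrIdx N) (σ × TrIdx N) ℝ) p q) ∧
        (∀ p : ℝ, 0 ≤ p →
          ((fun (z : B1Eq324BenfattoLemma.Site (θ.d₆ + 1 + (θ.d₆ + 1) + 1) → ℝ) (q : σ × TrIdx N) => z ((e' q : ↥Λ) : B1Eq324BenfattoLemma.Site (θ.d₆ + 1 + (θ.d₆ + 1) + 1))) ⁻¹'
              {ω : σ × TrIdx N → ℝ | ∀ q, |ω q| ≤ p}) =ᵐ[gaussianFieldOfKernel fun u w => if h : u ∈ Λ ∧ w ∈ Λ then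
                ((Matrix.reindex e' e'
                  (Matrix.of fun p q : σ × TrIdx N =>
                      trReForm (trBasis N p.2) (((CsDeltaCPstY x (lettersYOfRecordV4P N θ Mstar (resYOfC2 N θ Mstar 𝔠) x)
            (sectEStYOfRecordV7 N θ Mstar 𝔢₀ x) U).restrictScalars ℝ)
                        (Pi.single (ι q.1) (trBasis N q.2)) (ι p.1))))⁻¹ :
                    Matrix ↥Λ ↥Λ ℝ) ⟨u, h.1⟩ ⟨w, h.2⟩ else 0]
            smallFieldSet Λ p) ∧
        ∀ (s : ℕ) (I J : Finset (B1Eq324BenfattoLemma.Site (θ.d₆ + 1 + (θ.d₆ + 1) + 1))) (𝔞 : Coef (θ.d₆ + 1 + (θ.d₆ + 1) + 1)),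
          I.Nonempty → J ⊆ I → J ⊆ Λ → coefSup s D 𝔞 J ≤ c * η ^ σ' →
          0 < ∫ z, cutoffBoltzmann (hamiltonian s D ϰ 𝔞 J) I (B10.pFun b₀ p₀ η) z ∂(gaussianFieldOfKernel fun u w => if h : u ∈ Λ ∧ w ∈ Λ then
              ((Matrix.reindex e' e'
                (Matrix.of fun p q : σ × TrIdx N =>
                    trReForm (trBasis N p.2) (((CsDeltaCPstY x (lettersYOfRecordV4P N θ Mstar (resYOfC2 N θ Mstar 𝔠) x)
            (sectEStYOfRecordV7 N θ Mstar 𝔢₀ x) U).restrictScalars ℝ)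
                      (Pi.single (ι q.1) (trBasis N q.2)) (ι p.1))))⁻¹ :
                  Matrix ↥Λ ↥Λ ℝ) ⟨u, h.1⟩ ⟨w, h.2⟩ else 0) ∧
            |Real.log (∫ z, cutoffBoltzmann (hamiltonian s D ϰ 𝔞 J) I (B10.pFun b₀ p₀ η) z ∂(gaussianFieldOfKernel fun u w =>
                if h : u ∈ Λ ∧ w ∈ Λ then
                  ((Matrix.reindex e' e'
                    (Matrix.of fun p q : σ × TrIdx N =>
                        trReForm (trBasis N p.2) (((CsDeltaCPstY x (lettersYOfRecordV4P N θ Mstar (resYOfC2 N θ Mstar 𝔠) x)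
            (sectEStYOfRecordV7 N θ Mstar 𝔢₀ x) U).restrictScalars ℝ)
                          (Pi.single (ι q.1) (trBasis N q.2)) (ι p.1))))⁻¹ :
                      Matrix ↥Λ ↥Λ ℝ) ⟨u, h.1⟩ ⟨w, h.2⟩ else 0)) -
              cumulantSum (gaussianFieldOfKernel fun u w => if h : u ∈ Λ ∧ w ∈ Λ then
                  ((Matrix.reindex e' e'
                    (Matrix.of fun p q : σ × TrIdx N =>
                        trReForm (trBasis N p.2) (((CsDeltaCPstY x (lettersYOfRecordV4P N θ Mstar (resYOfC2 N θ Mstar 𝔠) x)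
            (sectEStYOfRecordV7 N θ Mstar 𝔢₀ x) U).restrictScalars ℝ)
                          (Pi.single (ι q.1) (trBasis N q.2)) (ι p.1))))⁻¹ :
                      Matrix ↥Λ ↥Λ ℝ) ⟨u, h.1⟩ ⟨w, h.2⟩ else 0)
                (hamiltonian s D ϰ 𝔞 J) t| ≤ C * η ^ κ' * I.card := by
  classical
  have hN : 0 < N := Nat.pos_of_ne_zero (NeZero.ne N)
  have hL1 : (1 : ℝ) ≤ ((θ.ℓ₆ + 1 : ℕ) : ℝ) := by exact_mod_cast Nat.succ_le_succ (Nat.zero_le _)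
  have hL0 : (0 : ℝ) < ((θ.ℓ₆ + 1 : ℕ) : ℝ) := lt_of_lt_of_le one_pos hL1
  -- row 26 of the certificate: the (3.132) kernel of `(QG₁Q*)⁻¹[G′_phys, Δ⁽²⁾]`, member-uniformly
  obtain ⟨M₄', δ₁, a₀', C, hM₄', hδ₁, ha₀', hC, h26x⟩ := h06.s3132
  -- Thm 3.12's (3.42)₁ letter for `G₁`
  obtain ⟨M₂, a₂, CG, δG, hM₂, ha₂, hCG, hδG, hGx⟩ := hG1fam
  -- the internal rates and the PinPrims record
  set δq : ℝ := min (δ₁ / 2) δG with hδq_def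
  have hδq : 0 < δq := lt_min (by linarith) hδG
  have hδq₁ : δq ≤ δ₁ / 2 := min_le_left _ _
  have hδqG : δq ≤ δG := min_le_right _ _
  let q : PinPrims := ⟨1 / 4, 0, 0, 0, 0, 1, 0, 0, 1, δq, 1, 1, 1 / 4, 0, 0, 0, 0, 0, 0, 0, fun _ => 0, fun _ => 0, fun _ => 0, fun _ => 0, fun _ _ => 0⟩
  have hq : q.OK :=
    { α_pos := by norm_num [q], α_lt := by norm_num [q], Nc_nn := le_rfl, N'_nn := le_rfl, NF_nn := le_rfl, one_le_Cℓ := le_rfl,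
      Kc_nn := le_rfl, θ₀_nn := le_rfl, B₀_pos := one_pos, δ₀_pos := hδq, a₁_pos := one_pos, M₁_pos := one_pos,
      αF_pos := by norm_num [q], αF_lt := by norm_num [q], NH_nn := le_rfl, NL_nn := le_rfl, BL_nn := le_rfl, NI_nn := le_rfl,
      N2_nn := le_rfl, B2_nn := le_rfl, θ2_nn := le_rfl, Bl_nn := fun _ _ _ => le_rfl, Bt_nn := fun _ _ _ => le_rfl,
      BI_nn := fun _ _ _ => le_rfl, BI2_nn := fun _ _ _ _ _ _ => le_rfl, θI_nn := fun _ _ => le_rfl }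
  have hqα : q.α = 1 / 4 := rfl
  have hqαF : q.αF = 1 / 4 := rfl
  have hqδ : q.δ₀ = δq := rfl
  -- the road constants
  set ρR : ℝ := 5 / 8 * δq with hρR_def
  have hρR : 0 < ρR := by positivity
  have hρ : q.αF * ((1 - 2 * q.α) * q.δ₀) + ρR ≤ (1 - q.α) * q.δ₀ := by rw [hqα, hqαF, hqδ, hρR_def]; linarith
  set rC : ℝ := max (cR39 (trBasis N) * (coordBound39 (trBasis N) * basisBound39 (trBasis N)) * C * (((θ.ℓ₆ + 1 : ℕ) : ℝ)) ^ 2) 0 with hrC_def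
  have hrC : 0 ≤ rC := le_max_right _ _
  have hB₃ : cR39 (trBasis N) * (coordBound39 (trBasis N) * basisBound39 (trBasis N)) * C * (((θ.ℓ₆ + 1 : ℕ) : ℝ)) ^ 2 ≤ rC := le_max_left _ _
  set aT : ℝ := min a₀' (min a₂ (10 * ((θ.ℓ₆ + 1 : ℕ) : ℝ) ^ 7)⁻¹) with haT_def
  have haT : 0 < aT := lt_min ha₀' (lt_min ha₂ (inv_pos.mpr (by positivity)))
  have haT₀ : aT ≤ a₀' := min_le_left _ _
  have haT₂ : aT ≤ a₂ := (min_le_right _ _).trans (min_le_left _ _)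
  have ha1 : 10 * ((θ.ℓ₆ + 1 : ℕ) : ℝ) ^ 7 * aT ≤ 1 := by
    have h1 : aT ≤ (10 * ((θ.ℓ₆ + 1 : ℕ) : ℝ) ^ 7)⁻¹ := (min_le_right _ _).trans (min_le_right _ _)
    have h2 : (0 : ℝ) < 10 * ((θ.ℓ₆ + 1 : ℕ) : ℝ) ^ 7 := by positivity
    calc 10 * ((θ.ℓ₆ + 1 : ℕ) : ℝ) ^ 7 * aT ≤ 10 * ((θ.ℓ₆ + 1 : ℕ) : ℝ) ^ 7 * (10 * ((θ.ℓ₆ + 1 : ℕ) : ℝ) ^ 7)⁻¹ := mul_le_mul_of_nonneg_left h1 h2.le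
      _ = 1 := mul_inv_cancel₀ h2.ne'
  -- the (3.132) → class → raw threshold: `2 log L ≤ (δ₁ − δ₁/2)·(2L² − 1)·M`
  set MC : ℝ := 2 * Real.log (((θ.ℓ₆ + 1 : ℕ) : ℝ)) / ((δ₁ - δ₁ / 2) * (2 * ((θ.ℓ₆ : ℝ) + 1) ^ 2 - 1)) with hMC_def
  have hden : 0 < (δ₁ - δ₁ / 2) * (2 * ((θ.ℓ₆ : ℝ) + 1) ^ 2 - 1) := by
    have h1 : 0 < δ₁ - δ₁ / 2 := by linarith
    have h2 : (1 : ℝ) ≤ ((θ.ℓ₆ : ℝ) + 1) ^ 2 := one_le_pow₀ (by linarith [(Nat.cast_nonneg θ.ℓ₆ : (0 : ℝ) ≤ θ.ℓ₆)])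
    exact mul_pos h1 (by linarith)
  set MT : ℝ := max M₄' (max M₂ MC) with hMT_def
  have hMT : 0 < MT := lt_max_of_lt_left hM₄'
  -- §A the raw (3.132) letter for `C₁` at the block count, rate `δq`, from row 26 (dag-n06-i's bridge + n06-w5's raw reading + the block-count dictionary)
  have hC1raw : ∀ x : B9PinMembersKLevelV1.MemberY θ.d₆ θ.ℓ₆ θ.hd' θ.hL' θ.b₀ θ.b₁ Mstar, MT ≤ (geo9Y x).M → ∀ α₀ : ℝ, 0 < α₀ → (geo9Y x).M * α₀ ≤ aT →
      ∀ U : (bg9Y (Matrix (Fin N) (Fin N) ℂ) (specialUnitaryUnits (Fin N)) x).Cfg,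
        (bg9YP (Matrix (Fin N) (Fin N) ℂ) (specialUnitaryUnits (Fin N)) x).Reg335 B9PinGeometryKLevelV1.c35Y α₀ U →
        (bg9YP (Matrix (Fin N) (Fin N) ℂ) (specialUnitaryUnits (Fin N)) x).Reg336 B9PinGeometryKLevelV1.c35Y α₀ U →
          HasMajorantHom (g := toB6 (geo9Y x) 1 (Hg x)) (blkHK x.toKIdx) (blkHK x.toKIdx)
            (C1coK x.toKIdx (trBasis N) (bg9Y (Matrix (Fin N) (Fin N) ℂ) (specialUnitaryUnits (Fin N)) x) (fun U => U)
              (parSymY x.toKIdx) (parBY x.toKIdx) (GpPhysY x.toKIdx (parSymY x.toKIdx)) (resYOfC2 N θ Mstar 𝔠 x).Δ2 U)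
            (fun a b => rC * ((geo9Y x).len a / etaBY x.toKIdx) ^ (θ.d₆ + 1) * ((geo9Y x).len b ^ 2)⁻¹ * Real.exp (-(q.δ₀ * (geo9Y x).dist a b))) := by
    intro x hMx α₀ hα ha U hU hU'
    letI : Fintype (geo9K x.toKIdx).Site := (inferInstance : Fintype (geo9Y x).Site)
    have hM₄x : M₄' ≤ (geo9Y x).M := (le_max_left _ _).trans hMx
    have hMCx : MC ≤ (geo9Y x).M := ((le_max_right _ _).trans (le_max_right M₄' _)).trans hMx
    have ha₀x : (geo9Y x).M * α₀ ≤ a₀' := ha.trans haT₀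
    have h26₁ : B9.Ineq3132 (θ.d₆ + 1)
        (siteKernelOfOpNu x.toKIdx (bg9Y (Matrix (Fin N) (Fin N) ℂ) (specialUnitaryUnits (Fin N)) x) (fun U => U) (nuY (θ.d₆ + 1) x.toKIdx)
          (QG1QinvY x.toKIdx (parSymY x.toKIdx) (parBY x.toKIdx) (GpPhysY x.toKIdx (parSymY x.toKIdx)) (resYOfC2 N θ Mstar 𝔠 x).Δ2)) C δ₁ U :=
      (h26x x hM₄x α₀ hα ha₀x U hU hU').2
    have hM : 2 * Real.log (((θ.ℓ₆ + 1 : ℕ) : ℝ)) ≤ (δ₁ - δ₁ / 2) * (2 * ((θ.ℓ₆ : ℝ) + 1) ^ 2 - 1) * (geo9Y x).M := by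
      have := (div_le_iff₀ hden).mp hMCx
      linarith [this]
    have hpl : ∀ y : (geo9Y x).Site, 0 ≤ (((((θ.ℓ₆ + 1 : ℕ) : ℝ)) ^ (θ.d₆ + 1)) ^ (lvl x.hN x.D x.hk y))⁻¹ := fun y => by positivity
    have hpl' : ∀ y : (geo9Y x).Site, 0 < (((((θ.ℓ₆ + 1 : ℕ) : ℝ)) ^ (θ.d₆ + 1)) ^ (lvl x.hN x.D x.hk y))⁻¹ := fun y => by positivity
    -- dag-n06-i's bridge: the `𝔠⁽²⁾ → Z_{n⁻¹}` class letter of `C₁` at rate `δ₁/2`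
    have hcls : HasMaj (cNorm 1 (Hg x) (blkHK x.toKIdx) (fun y => (geo9Y_len_pos x y).le) 2)
        (weightNorm (BlockNorm.ofBlocks (toB6 (geo9Y x) 1 (Hg x)) (blkHK x.toKIdx))
          (fun y => (((((θ.ℓ₆ + 1 : ℕ) : ℝ)) ^ (θ.d₆ + 1)) ^ (lvl x.hN x.D x.hk y))⁻¹) hpl)
        (C1coK x.toKIdx (trBasis N) (bg9Y (Matrix (Fin N) (Fin N) ℂ) (specialUnitaryUnits (Fin N)) x) (fun U => U)
          (parSymY x.toKIdx) (parBY x.toKIdx) (GpPhysY x.toKIdx (parSymY x.toKIdx)) (resYOfC2 N θ Mstar 𝔠 x).Δ2 U)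
        (fun a b' => rC * Real.exp (-(δ₁ / 2 * (geo9Y x).dist a b'))) := by
      have h := hasMaj_cNorm_weightNorm_coordOpK_geo9Y_of_ineq3132Nu (trBasis N) x
        (bg9Y (Matrix (Fin N) (Fin N) ℂ) (specialUnitaryUnits (Fin N)) x) (fun U => U)
        (QG1QinvY x.toKIdx (parSymY x.toKIdx) (parBY x.toKIdx) (GpPhysY x.toKIdx (parSymY x.toKIdx)) (resYOfC2 N θ Mstar 𝔠 x).Δ2)
        (norm_nonneg _) (abs_repr_le (trBasis N)) 1 (Hg x) (cR39 (trBasis N)) U (fun y => (geo9Y_len_pos x y).le) hpl hC.le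
        (show δ₁ / 2 < δ₁ by linarith) hM h26₁
      exact h.mono fun a b' => mul_le_mul_of_nonneg_right (const3132_le hB₃) (Real.exp_nonneg _)
    -- n06-w5's raw two-variable reading, then the block-count dictionary and the rate `δq ≤ δ₁/2`
    have hGeo : GeoOK (geo9Y x) := ⟨geo9Y_dist_triangle x, geo9Y_dist_comm x, geo9K_dist_nonneg x.toKIdx, geo9Y_len_pos x⟩
    have hraw := hasMajorantHom_raw_of_hasMaj_cNorm_weightNorm (R₀ := (1 : ℝ)) (H₀ := Hg x) hGeo
      (fun a b' => mul_nonneg hrC (Real.exp_nonneg _)) hpl' hcls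
    refine B6RandomWalkHom.hasMajorantHom_mono _ _ hraw fun a b' => ?_
    have hn : ((((((θ.ℓ₆ + 1 : ℕ) : ℝ)) ^ (θ.d₆ + 1)) ^ (lvl x.hN x.D x.hk a))⁻¹)⁻¹ = ((geo9Y x).len a / etaBY x.toKIdx) ^ (θ.d₆ + 1) := by
      rw [inv_inv, blockCount_eq_pow_lvl]
    have hd0 : 0 ≤ (geo9Y x).dist a b' := geo9K_dist_nonneg x.toKIdx a b'
    have hexp : Real.exp (-(δ₁ / 2 * (geo9Y x).dist a b')) ≤ Real.exp (-(q.δ₀ * (geo9Y x).dist a b')) := by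
      rw [hqδ]
      have h1 : δq * (geo9Y x).dist a b' ≤ δ₁ / 2 * (geo9Y x).dist a b' := mul_le_mul_of_nonneg_right hδq₁ hd0
      exact Real.exp_le_exp.mpr (neg_le_neg h1)
    have hnn : 0 ≤ ((geo9Y x).len a / etaBY x.toKIdx) ^ (θ.d₆ + 1) * ((geo9Y x).len b' ^ 2)⁻¹ :=
      mul_nonneg (pow_nonneg (div_nonneg (geo9Y_len_pos x a).le (etaBY_pos' x).le) _) (inv_nonneg.mpr (sq_nonneg _))
    rw [hn]
    calc rC * Real.exp (-(δ₁ / 2 * (geo9Y x).dist a b')) * (((geo9Y x).len a / etaBY x.toKIdx) ^ (θ.d₆ + 1) * ((geo9Y x).len b' ^ 2)⁻¹)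
        ≤ rC * Real.exp (-(q.δ₀ * (geo9Y x).dist a b')) * (((geo9Y x).len a / etaBY x.toKIdx) ^ (θ.d₆ + 1) * ((geo9Y x).len b' ^ 2)⁻¹) :=
          mul_le_mul_of_nonneg_right (mul_le_mul_of_nonneg_left hexp hrC) hnn
      _ = rC * ((geo9Y x).len a / etaBY x.toKIdx) ^ (θ.d₆ + 1) * ((geo9Y x).len b' ^ 2)⁻¹ * Real.exp (-(q.δ₀ * (geo9Y x).dist a b')) := by ring
  -- §B `G₁`'s (3.42)₁ letter at the road's rate `(1 − α)δq ≤ δG`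
  have hG1e0 : ∀ x : B9PinMembersKLevelV1.MemberY θ.d₆ θ.ℓ₆ θ.hd' θ.hL' θ.b₀ θ.b₁ Mstar, MT ≤ (geo9Y x).M → ∀ α₀ : ℝ, 0 < α₀ → (geo9Y x).M * α₀ ≤ aT →
      ∀ U : (bg9Y (Matrix (Fin N) (Fin N) ℂ) (specialUnitaryUnits (Fin N)) x).Cfg,
        (bg9YP (Matrix (Fin N) (Fin N) ℂ) (specialUnitaryUnits (Fin N)) x).Reg335 B9PinGeometryKLevelV1.c35Y α₀ U →
        (bg9YP (Matrix (Fin N) (Fin N) ℂ) (specialUnitaryUnits (Fin N)) x).Reg336 B9PinGeometryKLevelV1.c35Y α₀ U →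
          HasMajorant (g := toB6 (geo9Y x) 1 (Hg x)) (blkBK x.toKIdx (bI x))
            (GcoK x.toKIdx (trBasis N) (bg9Y (Matrix (Fin N) (Fin N) ℂ) (specialUnitaryUnits (Fin N)) x) (fun U => U)
              (G1Y x.toKIdx (parSymY x.toKIdx) (parBY x.toKIdx) (GpPhysY x.toKIdx (parSymY x.toKIdx)) (resYOfC2 N θ Mstar 𝔠 x).Δ2) U)
            (fun a b => CG * (geo9Y x).len a ^ 2 * Real.exp (-((1 - q.α) * q.δ₀ * (geo9Y x).dist a b))) := by
    intro x hMx α₀ hα ha U hU hU'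
    have hM₂x : M₂ ≤ (geo9Y x).M := ((le_max_left _ _).trans (le_max_right M₄' _)).trans hMx
    have h := hGx x hM₂x α₀ hα (ha.trans haT₂) U hU hU'
    rw [← B6RandomWalkHom.hasMajorantHom_iff] at h ⊢
    refine B6RandomWalkHom.hasMajorantHom_mono _ _ h fun a b' => ?_
    have hd0 : 0 ≤ (geo9Y x).dist a b' := geo9K_dist_nonneg x.toKIdx a b'
    have hexp : Real.exp (-(δG * (geo9Y x).dist a b')) ≤ Real.exp (-((1 - q.α) * q.δ₀ * (geo9Y x).dist a b')) := by
      rw [hqα, hqδ]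
      have h0 : (1 - 1 / 4) * δq ≤ δG := by linarith
      have h1 : (1 - 1 / 4) * δq * (geo9Y x).dist a b' ≤ δG * (geo9Y x).dist a b' := mul_le_mul_of_nonneg_right h0 hd0
      exact Real.exp_le_exp.mpr (neg_le_neg h1)
    exact mul_le_mul_of_nonneg_left hexp (mul_nonneg hCG (sq_nonneg _))
  -- §C the cancelling-road door at the internal record
  exact eq324_CsDeltaCPstY_lettersYOfRecordV4P_sectEStYOfRecordV7_trBasis_of_b9LeafX_of_G1e0C1rawLetters_of_pivotLines_ofC2_onΛst_on_unit N θ hD hD3 Mstar 𝔠 𝔡₂ 𝔢₀ 𝔢st 𝔴 𝔈 h06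
    hγ₀ hδV hC₂ hsmall t D hϰ hp₀ hσ hc hκ hκσ q hq Hg bI hbI0 hβ1 CG rC ρR _ MT aT hCG hrC hρR hMT haT ha1 hρ le_rfl hCr hG1e0 hC1raw


end Door

end Literature.MathematicalPhysics.QuantumFieldTheory.Balaban1983to89.B1Eq324BenfattoClassSectEMemberPrecisionDoorRecordV4PAdjCurrentCancelLeaf

end
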